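import Mathlib
import Summits.Ventures.PercRepro2.TwoSumPacking

/-!
# The pinned STEP family is closed under the 2-sum with a piece of packing number ≤ 1
(seat mine-b, cell pub-perc-repro2; conjectures/MINE-B.md §13)

**Theorem** (`absH_twoSum_le`).  If `A₂` has packing number ≤ 1 and `A₁` satisfies the pinned STEP
inequality `H(i,j) ≤ H(i+1,j−1)` on every pattern, then so does the 2-sum `twoSum A₁ A₂ p`
(TwoSumPacking.lean), on every pattern `(O, Y)` of `E₁ ⊕ E₂` not containing `p`.  The proof is a
coupling: the configurations of the composite pattern are fibred over the colourings `γ₂` of the right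
part (`absH_twoSum_eq_sum`); on a fibre the composite packing numbers are those of `A₁` with `p`
pinned (both colours carry `A₂`), deleted (neither), or given to the one colour that carries `A₂`
(`kDisj_twoSum_iff`); the fibres of the two one-sided kinds are paired by the colour swap
`γ₂ ↦ Y₂ \ γ₂` of the piece and each pair adds up to the pattern of `A₁` with `p` in the split set
(`fibH_add_fibH_sdiff`).  So the composite count is a non-negative combination
`c · H(del) + e · H(pin) + d · H(Y ∪ p)` of three pattern counts of `A₁`, and STEP is inherited row by
row — with no hypothesis on `A₂` beyond packing ≤ 1: the piece's own law only supplies the weights.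
For ports: STEP for every port of `M₁` gives STEP for the port of `M₁ ⊕₂ F₇*` at every element of `M₁`
(the `F₇*`-leaf step of Seymour's 1981 decomposition of `F₇`-free binary matroids); the subdivision
of an edge (series composition, StepClosure.lean) is the case of a path.
-/

open Finset

namespace Summit.Ventures.PercRepro2

namespace StepZero

open ReimerCube

variable {E₁ E₂ : Type*} [DecidableEq E₁]

open Classical

/-! ## The composite pattern count, fibred over the colourings of the piece -/

section Pattern

variable [DecidableEq E₂]

omit [DecidableEq E₁] [DecidableEq E₂] in
/-- a filtered count over the subsets of `Y ⊆ E₁ ⊕ E₂` is the sum, over the right parts `γ₂`, of the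
filtered counts over the left parts -/
lemma card_filter_powerset_sum (Y : Finset (E₁ ⊕ E₂)) (P : Finset (E₁ ⊕ E₂) → Prop)
    [DecidablePred P] :
    (Y.powerset.filter P).card
      = ∑ γ₂ ∈ Y.toRight.powerset, (Y.toLeft.powerset.filter (fun γ₁ => P (γ₁.disjSum γ₂))).card := by
  have h1 : (Y.powerset.filter P).card
      = ((Y.toLeft.powerset ×ˢ Y.toRight.powerset).filter (fun q => P (q.1.disjSum q.2))).card := by
    refine Finset.card_bij' (fun γ _ => (γ.toLeft, γ.toRight)) (fun q _ => q.1.disjSum q.2) ?_ ?_ ?_ ?_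
    · intro γ hγ
      rw [Finset.mem_filter, Finset.mem_powerset] at hγ
      rw [Finset.mem_filter, Finset.mem_product, Finset.mem_powerset, Finset.mem_powerset]
      refine ⟨⟨Finset.toLeft_subset_toLeft hγ.1, Finset.toRight_subset_toRight hγ.1⟩, ?_⟩
      simpa only [Finset.toLeft_disjSum_toRight] using hγ.2
    · intro q hq
      rw [Finset.mem_filter, Finset.mem_product, Finset.mem_powerset, Finset.mem_powerset] at hq
      rw [Finset.mem_filter, Finset.mem_powerset, Finset.disjSum_subset]
      exact ⟨hq.1, hq.2⟩
    · intro γ _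
      exact Finset.toLeft_disjSum_toRight
    · intro q _
      simp only [Finset.toLeft_disjSum, Finset.toRight_disjSum]
  rw [h1, Finset.card_filter, Finset.sum_product_right]
  refine Finset.sum_congr rfl (fun γ₂ _ => ?_)
  rw [Finset.card_filter]

/-- the fibre count of the composite pattern over a colouring `γ₂` of the right split set: the number
of left colourings `γ₁ ⊆ Y₁` whose composite configuration has red packing exactly `i` and blue
packing `≥ j`; `p` is given to a colour exactly when that colour carries `A₂` on the right -/
noncomputable def fibH (A₁ : Finset E₁ → Prop) (A₂ : Finset E₂ → Prop) (p : E₁) (O₁ Y₁ : Finset E₁)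
    (O₂ Y₂ : Finset E₂) (i j : ℕ) (γ₂ : Finset E₂) : ℕ :=
  (Y₁.powerset.filter (fun γ₁ =>
    kDisj A₁ i (O₁ ∪ (Y₁ \ γ₁) ∪ (if A₂ (O₂ ∪ (Y₂ \ γ₂)) then {p} else ∅)) ∧
    ¬ kDisj A₁ (i + 1) (O₁ ∪ (Y₁ \ γ₁) ∪ (if A₂ (O₂ ∪ (Y₂ \ γ₂)) then {p} else ∅)) ∧
    kDisj A₁ j (O₁ ∪ γ₁ ∪ (if A₂ (O₂ ∪ γ₂) then {p} else ∅)))).card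

/-- the left configuration of `O ∪ Z` for `Z` a disjoint sum, when `p` is not in the left parts -/
lemma leftCfg_union_disjSum (A₂ : Finset E₂ → Prop) (p : E₁) (O : Finset (E₁ ⊕ E₂)) (Z₁ : Finset E₁)
    (Z₂ : Finset E₂) (hpO : p ∉ O.toLeft) (hpZ : p ∉ Z₁) :
    leftCfg A₂ p (O ∪ Z₁.disjSum Z₂)
      = O.toLeft ∪ Z₁ ∪ (if A₂ (O.toRight ∪ Z₂) then {p} else ∅) := by
  unfold leftCfg
  rw [Finset.toLeft_union, Finset.toRight_union, Finset.toLeft_disjSum, Finset.toRight_disjSum,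
    Finset.erase_eq_of_notMem]
  rw [Finset.mem_union, not_or]
  exact ⟨hpO, hpZ⟩

/-- **The composite count, fibred over the piece.**  For a pattern `(O, Y)` of the 2-sum not containing
`p`, `H(i,j)` of the composite is the sum over the right colourings `γ₂ ⊆ Y₂` of the fibre counts. -/
theorem absH_twoSum_eq_sum {A₁ : Finset E₁ → Prop} {A₂ : Finset E₂ → Prop} (hA₁ : Incr A₁)
    (hA₂ : Incr A₂) (h₂ : ∀ S, ¬ DOcc A₂ A₂ S) (p : E₁) (O Y : Finset (E₁ ⊕ E₂))
    (hp : Sum.inl p ∉ O ∪ Y) (i j : ℕ) :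
    absH (twoSum A₁ A₂ p) O Y i j
      = ∑ γ₂ ∈ Y.toRight.powerset, fibH A₁ A₂ p O.toLeft Y.toLeft O.toRight Y.toRight i j γ₂ := by
  have hpO : p ∉ O.toLeft := fun h => hp (Finset.mem_union_left _ (Finset.mem_toLeft.mp h))
  have hpY : p ∉ Y.toLeft := fun h => hp (Finset.mem_union_right _ (Finset.mem_toLeft.mp h))
  unfold absH
  rw [card_filter_powerset_sum]
  refine Finset.sum_congr rfl (fun γ₂ _ => ?_)
  unfold fibH
  congr 1
  ext γ₁
  rw [Finset.mem_filter, Finset.mem_filter]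
  apply and_congr_right
  intro hγ₁
  rw [Finset.mem_powerset] at hγ₁
  have hpγ : p ∉ γ₁ := fun h => hpY (hγ₁ h)
  have hpd : p ∉ Y.toLeft \ γ₁ := fun h => hpY (Finset.mem_sdiff.mp h).1
  have hsd : Y \ γ₁.disjSum γ₂ = (Y.toLeft \ γ₁).disjSum (Y.toRight \ γ₂) := by
    conv_lhs => rw [← Finset.toLeft_disjSum_toRight (u := Y)]
    ext (x | y) <;> simp
  unfold pinK
  rw [kDisj_twoSum_iff hA₁ hA₂ h₂, kDisj_twoSum_iff hA₁ hA₂ h₂, kDisj_twoSum_iff hA₁ hA₂ h₂, hsd,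
    leftCfg_union_disjSum A₂ p O _ _ hpO hpd, leftCfg_union_disjSum A₂ p O _ _ hpO hpγ]

omit [DecidableEq E₂] in
/-- set identity behind the pinned fibre -/
lemma union_union_singleton_eq (O₁ S : Finset E₁) (p : E₁) : O₁ ∪ S ∪ {p} = insert p O₁ ∪ S := by
  ext x
  simp only [Finset.mem_union, Finset.mem_singleton, Finset.mem_insert]
  tauto

omit [DecidableEq E₂] in
/-- set identity behind the split fibre -/
lemma union_union_singleton_eq' (O₁ S : Finset E₁) (p : E₁) : O₁ ∪ S ∪ {p} = O₁ ∪ insert p S := by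
  ext x
  simp only [Finset.mem_union, Finset.mem_singleton, Finset.mem_insert]
  tauto

/-- the fibre over a colouring carried by both colours is the pinned pattern of `A₁` -/
lemma fibH_of_both {A₁ : Finset E₁ → Prop} {A₂ : Finset E₂ → Prop} (p : E₁) (O₁ Y₁ : Finset E₁)
    (O₂ Y₂ : Finset E₂) (i j : ℕ) (γ₂ : Finset E₂) (hb : A₂ (O₂ ∪ γ₂)) (hr : A₂ (O₂ ∪ (Y₂ \ γ₂))) :
    fibH A₁ A₂ p O₁ Y₁ O₂ Y₂ i j γ₂ = absH A₁ (insert p O₁) Y₁ i j := by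
  unfold fibH absH pinK
  simp only [hb, hr, if_true]
  congr 1
  ext γ₁
  rw [Finset.mem_filter, Finset.mem_filter]
  apply and_congr_right
  intro _
  rw [union_union_singleton_eq, union_union_singleton_eq]

/-- the fibre over a colouring carried by neither colour is the deleted pattern of `A₁` -/
lemma fibH_of_neither {A₁ : Finset E₁ → Prop} {A₂ : Finset E₂ → Prop} (p : E₁) (O₁ Y₁ : Finset E₁)
    (O₂ Y₂ : Finset E₂) (i j : ℕ) (γ₂ : Finset E₂) (hb : ¬ A₂ (O₂ ∪ γ₂))
    (hr : ¬ A₂ (O₂ ∪ (Y₂ \ γ₂))) :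
    fibH A₁ A₂ p O₁ Y₁ O₂ Y₂ i j γ₂ = absH A₁ O₁ Y₁ i j := by
  unfold fibH absH pinK
  simp only [hb, hr, if_false, Finset.union_empty]

omit [DecidableEq E₂] in
/-- the `p`-red half of the split pattern `(O₁, insert p Y₁)` of `A₁`, indexed by the trace on `Y₁` -/
noncomputable def splitRed (A₁ : Finset E₁ → Prop) (p : E₁) (O₁ Y₁ : Finset E₁) (i j : ℕ) : ℕ :=
  (Y₁.powerset.filter (fun S => pinK A₁ O₁ i (insert p Y₁ \ S) ∧ ¬ pinK A₁ O₁ (i + 1) (insert p Y₁ \ S)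
    ∧ pinK A₁ O₁ j S)).card

omit [DecidableEq E₂] in
/-- the `p`-blue half of the split pattern `(O₁, insert p Y₁)` of `A₁`, indexed by the trace on `Y₁` -/
noncomputable def splitBlue (A₁ : Finset E₁ → Prop) (p : E₁) (O₁ Y₁ : Finset E₁) (i j : ℕ) : ℕ :=
  (Y₁.powerset.filter (fun S => pinK A₁ O₁ i (insert p Y₁ \ insert p S)
    ∧ ¬ pinK A₁ O₁ (i + 1) (insert p Y₁ \ insert p S) ∧ pinK A₁ O₁ j (insert p S))).card

omit [DecidableEq E₂] in
/-- the split pattern of `A₁` is the sum of its `p`-red and `p`-blue halves -/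
lemma absH_insert_eq {A₁ : Finset E₁ → Prop} (p : E₁) (O₁ Y₁ : Finset E₁) (hpY : p ∉ Y₁) (i j : ℕ) :
    absH A₁ O₁ (insert p Y₁) i j = splitRed A₁ p O₁ Y₁ i j + splitBlue A₁ p O₁ Y₁ i j := by
  unfold absH splitRed splitBlue
  exact card_filter_powerset_insert hpY
    (fun γ => pinK A₁ O₁ i (insert p Y₁ \ γ) ∧ ¬ pinK A₁ O₁ (i + 1) (insert p Y₁ \ γ) ∧ pinK A₁ O₁ j γ)

/-- the fibre over a colouring carried by blue only is the `p`-blue half of the split pattern -/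
lemma fibH_of_blue {A₁ : Finset E₁ → Prop} {A₂ : Finset E₂ → Prop} (p : E₁) (O₁ Y₁ : Finset E₁)
    (hpY : p ∉ Y₁) (O₂ Y₂ : Finset E₂) (i j : ℕ) (γ₂ : Finset E₂) (hb : A₂ (O₂ ∪ γ₂))
    (hr : ¬ A₂ (O₂ ∪ (Y₂ \ γ₂))) :
    fibH A₁ A₂ p O₁ Y₁ O₂ Y₂ i j γ₂ = splitBlue A₁ p O₁ Y₁ i j := by
  unfold fibH splitBlue pinK
  simp only [hb, hr, if_true, if_false, Finset.union_empty]
  congr 1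
  ext γ₁
  rw [Finset.mem_filter, Finset.mem_filter]
  apply and_congr_right
  intro _
  rw [insert_sdiff_insert' hpY, union_union_singleton_eq']

/-- the fibre over a colouring carried by red only is the `p`-red half of the split pattern -/
lemma fibH_of_red {A₁ : Finset E₁ → Prop} {A₂ : Finset E₂ → Prop} (p : E₁) (O₁ Y₁ : Finset E₁)
    (hpY : p ∉ Y₁) (O₂ Y₂ : Finset E₂) (i j : ℕ) (γ₂ : Finset E₂) (hb : ¬ A₂ (O₂ ∪ γ₂))
    (hr : A₂ (O₂ ∪ (Y₂ \ γ₂))) :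
    fibH A₁ A₂ p O₁ Y₁ O₂ Y₂ i j γ₂ = splitRed A₁ p O₁ Y₁ i j := by
  unfold fibH splitRed pinK
  simp only [hb, hr, if_true, if_false, Finset.union_empty]
  congr 1
  ext γ₁
  rw [Finset.mem_filter, Finset.mem_filter]
  apply and_congr_right
  intro hγ₁
  rw [Finset.mem_powerset] at hγ₁
  rw [insert_sdiff_of_not_mem' hγ₁ hpY, union_union_singleton_eq']

/-- **the colour swap of the piece pairs the fibres**: `fib(γ₂) + fib(Y₂ \ γ₂)` is twice the pinned
pattern count of `A₁`, twice the deleted one, or the pattern of `A₁` with `p` in the split set -/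
theorem fibH_add_fibH_sdiff {A₁ : Finset E₁ → Prop} (A₂ : Finset E₂ → Prop) (p : E₁)
    (O₁ Y₁ : Finset E₁) (hpY : p ∉ Y₁) (O₂ Y₂ : Finset E₂) (i j : ℕ) (γ₂ : Finset E₂)
    (hγ₂ : γ₂ ⊆ Y₂) :
    fibH A₁ A₂ p O₁ Y₁ O₂ Y₂ i j γ₂ + fibH A₁ A₂ p O₁ Y₁ O₂ Y₂ i j (Y₂ \ γ₂)
      = if A₂ (O₂ ∪ γ₂) ∧ A₂ (O₂ ∪ (Y₂ \ γ₂)) then 2 * absH A₁ (insert p O₁) Y₁ i j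
        else if ¬ A₂ (O₂ ∪ γ₂) ∧ ¬ A₂ (O₂ ∪ (Y₂ \ γ₂)) then 2 * absH A₁ O₁ Y₁ i j
        else absH A₁ O₁ (insert p Y₁) i j := by
  have hss : Y₂ \ (Y₂ \ γ₂) = γ₂ := Finset.sdiff_sdiff_eq_self hγ₂
  by_cases hb : A₂ (O₂ ∪ γ₂) <;> by_cases hr : A₂ (O₂ ∪ (Y₂ \ γ₂))
  · rw [fibH_of_both p O₁ Y₁ O₂ Y₂ i j γ₂ hb hr,
      fibH_of_both p O₁ Y₁ O₂ Y₂ i j _ hr (by rw [hss]; exact hb)]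
    simp only [hb, hr, and_self, if_true, two_mul]
  · rw [fibH_of_blue p O₁ Y₁ hpY O₂ Y₂ i j γ₂ hb hr,
      fibH_of_red p O₁ Y₁ hpY O₂ Y₂ i j _ hr (by rw [hss]; exact hb), absH_insert_eq p O₁ Y₁ hpY,
      add_comm]
    simp only [hb, hr, and_false, if_false, not_true_eq_false, false_and]
  · rw [fibH_of_red p O₁ Y₁ hpY O₂ Y₂ i j γ₂ hb hr,
      fibH_of_blue p O₁ Y₁ hpY O₂ Y₂ i j _ hr (by rw [hss]; exact hb), absH_insert_eq p O₁ Y₁ hpY]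
    simp only [hb, hr, false_and, if_false, not_true_eq_false, and_false]
  · rw [fibH_of_neither p O₁ Y₁ O₂ Y₂ i j γ₂ hb hr,
      fibH_of_neither p O₁ Y₁ O₂ Y₂ i j _ hr (by rw [hss]; exact hb)]
    simp only [hb, hr, if_false, not_false_eq_true, and_self, if_true, two_mul]

/-- the sum of the fibres is invariant under the colour swap of the piece -/
lemma sum_fibH_sdiff {A₁ : Finset E₁ → Prop} (A₂ : Finset E₂ → Prop) (p : E₁) (O₁ Y₁ : Finset E₁)
    (O₂ Y₂ : Finset E₂) (i j : ℕ) :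
    ∑ γ₂ ∈ Y₂.powerset, fibH A₁ A₂ p O₁ Y₁ O₂ Y₂ i j (Y₂ \ γ₂)
      = ∑ γ₂ ∈ Y₂.powerset, fibH A₁ A₂ p O₁ Y₁ O₂ Y₂ i j γ₂ := by
  refine Finset.sum_nbij' (fun γ₂ => Y₂ \ γ₂) (fun γ₂ => Y₂ \ γ₂) ?_ ?_ ?_ ?_ ?_
  · intro γ₂ _
    exact Finset.mem_powerset.mpr Finset.sdiff_subset
  · intro γ₂ _
    exact Finset.mem_powerset.mpr Finset.sdiff_subset
  · intro γ₂ hγ₂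
    exact Finset.sdiff_sdiff_eq_self (Finset.mem_powerset.mp hγ₂)
  · intro γ₂ hγ₂
    exact Finset.sdiff_sdiff_eq_self (Finset.mem_powerset.mp hγ₂)
  · intro γ₂ _
    rfl

/-- **Pinned STEP is closed under the 2-sum with a piece of packing number ≤ 1.**  If `A₂` has no two
disjoint witnesses anywhere and `A₁` satisfies `H(i,j) ≤ H(i+1,j−1)` on every pattern, then the 2-sum
`twoSum A₁ A₂ p` satisfies it on every pattern `(O, Y)` of `E₁ ⊕ E₂` not containing `p`. -/
theorem absH_twoSum_le {A₁ : Finset E₁ → Prop} {A₂ : Finset E₂ → Prop} (hA₁ : Incr A₁)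
    (hA₂ : Incr A₂) (h₂ : ∀ S, ¬ DOcc A₂ A₂ S) (p : E₁) (i j : ℕ)
    (hstep : ∀ O Y : Finset E₁, absH A₁ O Y i j ≤ absH A₁ O Y (i + 1) (j - 1))
    (O Y : Finset (E₁ ⊕ E₂)) (hp : Sum.inl p ∉ O ∪ Y) :
    absH (twoSum A₁ A₂ p) O Y i j ≤ absH (twoSum A₁ A₂ p) O Y (i + 1) (j - 1) := by
  have hpY : p ∉ Y.toLeft := fun h => hp (Finset.mem_union_right _ (Finset.mem_toLeft.mp h))
  rw [absH_twoSum_eq_sum hA₁ hA₂ h₂ p O Y hp, absH_twoSum_eq_sum hA₁ hA₂ h₂ p O Y hp]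
  -- pair every fibre with its colour swap: `2 Σ fib = Σ (fib γ₂ + fib (Y₂ \ γ₂))`
  have key : ∀ i' j', 2 * ∑ γ₂ ∈ Y.toRight.powerset,
        fibH A₁ A₂ p O.toLeft Y.toLeft O.toRight Y.toRight i' j' γ₂
      = ∑ γ₂ ∈ Y.toRight.powerset, (fibH A₁ A₂ p O.toLeft Y.toLeft O.toRight Y.toRight i' j' γ₂
          + fibH A₁ A₂ p O.toLeft Y.toLeft O.toRight Y.toRight i' j' (Y.toRight \ γ₂)) := by
    intro i' j'
    rw [Finset.sum_add_distrib, sum_fibH_sdiff, two_mul]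
  have hle : ∑ γ₂ ∈ Y.toRight.powerset, (fibH A₁ A₂ p O.toLeft Y.toLeft O.toRight Y.toRight i j γ₂
          + fibH A₁ A₂ p O.toLeft Y.toLeft O.toRight Y.toRight i j (Y.toRight \ γ₂))
      ≤ ∑ γ₂ ∈ Y.toRight.powerset,
          (fibH A₁ A₂ p O.toLeft Y.toLeft O.toRight Y.toRight (i + 1) (j - 1) γ₂
          + fibH A₁ A₂ p O.toLeft Y.toLeft O.toRight Y.toRight (i + 1) (j - 1) (Y.toRight \ γ₂)) := by
    apply Finset.sum_le_sum
    intro γ₂ hγ₂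
    have hγ₂' := Finset.mem_powerset.mp hγ₂
    rw [fibH_add_fibH_sdiff A₂ p O.toLeft Y.toLeft hpY O.toRight Y.toRight i j γ₂ hγ₂',
      fibH_add_fibH_sdiff A₂ p O.toLeft Y.toLeft hpY O.toRight Y.toRight (i + 1) (j - 1) γ₂ hγ₂']
    by_cases hb : A₂ (O.toRight ∪ γ₂) <;> by_cases hr : A₂ (O.toRight ∪ (Y.toRight \ γ₂))
    · simp only [hb, hr, and_self, if_true]
      exact Nat.mul_le_mul_left 2 (hstep _ _)
    · simp only [hb, hr, and_false, if_false, not_true_eq_false, false_and]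
      exact hstep _ _
    · simp only [hb, hr, false_and, if_false, not_true_eq_false, and_false]
      exact hstep _ _
    · simp only [hb, hr, if_false, not_false_eq_true, and_self, if_true]
      exact Nat.mul_le_mul_left 2 (hstep _ _)
  rw [← key, ← key] at hle
  omega

end Pattern

end StepZero

end Summit.Ventures.PercRepro2
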